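import Mathlib.Data.Fin.Tuple.Sort
import Literature.NumberTheory.Automorphic.ParabolicGL
import Literature.NumberTheory.Automorphic.ParabolicInduction
import Literature.NumberTheory.Automorphic.IwasawaDecompositionGL
import Literature.NumberTheory.Automorphic.ReductiveGroupData
import Literature.NumberTheory.Automorphic.GLReindex
import Literature.NumberTheory.Automorphic.JacquetModuleProofs
import HarnessLib

/-!
# Parabolic induction on `GL_n(F)` preserves admissibility
(proof of `Representation.isAdmissible_parabolicIndGL`)

This file discharges the named fact `Representation.isAdmissible_parabolicIndGL` of
`Literature.NumberTheory.Automorphic.ParabolicGL`: for a non-archimedean local field `F`, a block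
labelling `c : n → α` and an admissible representation `σ` of the standard Levi
`Π_a GL_{n_a}(F)`, the normalised parabolically induced representation
`i_c σ = Ind_{P_c}^{GL_n(F)} (σ ∘ proj ⊗ δ_{P_c}^{1/2})` (`Representation.parabolicIndGL`) is
admissible (Bernstein–Zelevinsky 1977, Prop. 2.3 (e), reduced there to Prop. 1.9 (e): "Suppose
that `G` is compact modulo `P = MU`. Then the functors `I_{U,θ}` and `i_{U,θ}` … carry admissible
representations into admissible ones"; the proof is the one of Bernstein–Zelevinsky 1976,
§2.25, cf. Bushnell–Henniart 2006, §2.4).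

## Proof

Let `K ≤ GL_n(F)` be compact open and `f ∈ (i_c σ)^K`, so `f (p g k) = τ(p) f(g)` for `p ∈ P_c`,
`k ∈ K`, where `τ = σ ∘ proj ⊗ δ^{1/2}`.
* **Iwasawa decomposition** (`exists_isCompact_isOpen_forall_standardParabolicGL_mul`):
  `GL_n(F) = P_c · K₀` with `K₀ = GL_n(𝒪)` compact open — transported from the tree's
  `exists_borel_mul_glInt` (`GL (Fin N) F = B · GL_N(𝒪)`, `IwasawaDecompositionGL`) along an
  enumeration `e : Fin N ≃ n` making `c ∘ e` monotone (`Tuple.sort`), so that `e · B ≤ P_c`.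
* `K₀` is covered by finitely many cosets `s K` (`exists_finset_forall_inv_mul_mem`), hence every
  `g` is `p s k` with `s` in a finite set `t`, and `f ↦ (f(s))_{s ∈ t}` is injective on `(i_c σ)^K`.
* `f(s)` is fixed by `σ(proj(P_c ∩ s K s⁻¹))`: for `p ∈ P_c ∩ s K s⁻¹`,
  `τ(p) f(s) = f(p s) = f(s · s⁻¹ p s) = f(s)`, and `δ_{P_c}(p) = 1` because `P_c ∩ s K s⁻¹` is a
  compact open subgroup of `P_c` (`DeltaCharBorel.modularCharacter_eq_one_of_mem`: an element
  normalising a compact open subgroup has modulus `1`).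
* `proj(P_c ∩ s K s⁻¹) ≤ Π_a GL_{n_a}(F)` is compact (continuity of the Levi projection) and open
  (it contains the preimage of `s K s⁻¹` under the continuous Levi embedding), so by admissibility
  of `σ` its fixed vectors are finite-dimensional; hence so is `(i_c σ)^K`.

## Main declarations

* `Representation.isAdmissible_parabolicIndGL_holds` — the discharge;
* `Literature.NumberTheory.Automorphic.exists_isCompact_isOpen_forall_standardParabolicGL_mul` —
  Iwasawa decomposition `GL_n(F) = P_c K₀` for an arbitrary finite index type;
* private copies `continuous_leviProjection'`, `continuous_blockDiagonalGL'` of the continuity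
  lemmas of `ParabolicSemidirect` (not imported: it carries the adelic theory); lemmas on the subgroup
  `P ∩ s K s⁻¹ ≤ ↥P` (written `K.comap ((MulAut.conj s).symm ∘ P.subtype)`, no new definition):
  `isOpen_comap_conj_symm_subtype`, `isCompact_comap_conj_symm_subtype`,
  `modularCharacter_eq_one_of_mem_comap_conj`.

## References

* I. N. Bernstein, A. V. Zelevinsky, *Induced representations of reductive `p`-adic groups I*,
  Ann. Sci. ÉNS (4) 10 (1977), 441–472, Prop. 1.9 (e), Prop. 2.3 (e).
* I. N. Bernstein, A. V. Zelevinsky, *Representations of the group `GL(n, F)` where `F` is a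
  non-archimedean local field*, Russian Math. Surveys 31 (1976), §2.25.
* C. J. Bushnell, G. Henniart, *The local Langlands conjecture for `GL(2)`* (2006), §2.4.
-/

noncomputable section

open scoped MatrixGroups NNReal
open MeasureTheory Topology

namespace Literature.NumberTheory.Automorphic

/-! ### Compact sets, open subgroups and conjugates -/

section General

variable {G : Type*} [Group G] [TopologicalSpace G] [IsTopologicalGroup G]

/-- A compact subset `C` of a topological group is covered by finitely many left cosets `s K` of
an open subgroup `K`: there is a finite set `t` with `∀ x ∈ C, ∃ s ∈ t, s⁻¹ x ∈ K`. [folklore] -/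
theorem exists_finset_forall_inv_mul_mem {C : Set G} (hC : IsCompact C) {K : Subgroup G}
    (hK : IsOpen (K : Set G)) : ∃ t : Finset G, ∀ x ∈ C, ∃ s ∈ t, s⁻¹ * x ∈ K := by
  obtain ⟨t, ht⟩ := hC.elim_finite_subcover (fun s : G => (s * ·) '' (K : Set G))
    (fun s => isOpenMap_mul_left s _ hK)
    (fun x _ => Set.mem_iUnion.2 ⟨x, 1, K.one_mem, mul_one x⟩)
  refine ⟨t, fun x hx => ?_⟩
  obtain ⟨s, hs, hx'⟩ := Set.mem_iUnion₂.1 (ht hx)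
  obtain ⟨k, hk, rfl⟩ := hx'
  exact ⟨s, hs, by rwa [inv_mul_cancel_left]⟩

omit [TopologicalSpace G] [IsTopologicalGroup G] in
/-- Membership in the subgroup `P ∩ s K s⁻¹` viewed inside `↥P`, i.e. the preimage of `K` under
`p ↦ s⁻¹ p s` (Mathlib `Subgroup.comap` of `(MulAut.conj s)⁻¹ ∘ P.subtype`; the stabiliser in `P`
of the coset `s K`): `p ∈ P ∩ s K s⁻¹ ↔ s⁻¹ p s ∈ K`. [folklore] -/
@[simp] lemma mem_comap_conj_symm_subtype {P K : Subgroup G} {s : G} {p : P} :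
    p ∈ K.comap ((MulAut.conj s).symm.toMonoidHom.comp P.subtype) ↔ s⁻¹ * (p : G) * s ∈ K := by
  simp [MulAut.conj_symm_apply]

omit [TopologicalSpace G] [IsTopologicalGroup G] in
/-- `P ∩ s K s⁻¹ ≤ ↥P` as a set is the preimage of `K` under `p ↦ s⁻¹ p s`. [folklore] -/
lemma coe_comap_conj_symm_subtype (P K : Subgroup G) (s : G) :
    (K.comap ((MulAut.conj s).symm.toMonoidHom.comp P.subtype) : Set P) =
      Subtype.val ⁻¹' ((fun x : G => s⁻¹ * x * s) ⁻¹' (K : Set G)) := by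
  ext p
  simp

/-- `P ∩ s K s⁻¹` is open in `P` when `K` is open. [folklore] -/
lemma isOpen_comap_conj_symm_subtype (P : Subgroup G) {K : Subgroup G} (hK : IsOpen (K : Set G))
    (s : G) : IsOpen (K.comap ((MulAut.conj s).symm.toMonoidHom.comp P.subtype) : Set P) := by
  rw [coe_comap_conj_symm_subtype]
  exact (hK.preimage (by fun_prop)).preimage continuous_subtype_val

/-- `P ∩ s K s⁻¹` is compact (in `P`) when `P` is closed and `K` is compact. [folklore] -/
lemma isCompact_comap_conj_symm_subtype {P K : Subgroup G} (hP : IsClosed (P : Set G))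
    (hK : IsCompact (K : Set G)) (s : G) :
    IsCompact (K.comap ((MulAut.conj s).symm.toMonoidHom.comp P.subtype) : Set P) := by
  rw [coe_comap_conj_symm_subtype]
  refine hP.isClosedEmbedding_subtypeVal.isCompact_preimage ?_
  exact ((Homeomorph.mulLeft s⁻¹).trans (Homeomorph.mulRight s)).isCompact_preimage.2 hK

/-- The modular character of a closed subgroup `P` is trivial on `P ∩ s K s⁻¹` for `K` compact
open: a compact open subgroup of `P` is normalised by its elements, so they have modulus `1`
(Bernstein–Zelevinsky 1977, 1.7: "a positive character of a compact group is trivial"). [folklore] -/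
lemma modularCharacter_eq_one_of_mem_comap_conj {P K : Subgroup G} [LocallyCompactSpace P]
    (hP : IsClosed (P : Set G)) (hKo : IsOpen (K : Set G)) (hK : IsCompact (K : Set G)) {s : G}
    {p : P} (hp : p ∈ K.comap ((MulAut.conj s).symm.toMonoidHom.comp P.subtype)) :
    Measure.modularCharacter p = 1 := by
  borelize ↥P
  exact DeltaCharBorel.modularCharacter_eq_one_of_mem Measure.haar
    (isOpen_comap_conj_symm_subtype P hKo s) (isCompact_comap_conj_symm_subtype hP hK s) hp

end General

/-! ### Continuity of the Levi projection and of the Levi embedding -/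

section Levi

variable {R : Type*} [CommRing R] [TopologicalSpace R] [IsTopologicalRing R]
  {n : Type*} [Fintype n] [DecidableEq n] {α : Type*} [LinearOrder α] (c : n → α)

/-- The Levi projection `P_c → Π_a GL_{n_a}(R)` ("take the diagonal blocks") is continuous: its
entries and the entries of the inverse blocks (the diagonal blocks of `p⁻¹`) are matrix entries of
`p` and `p⁻¹`. (A private copy of `Literature.NumberTheory.Automorphic.continuous_leviProjection`
of `ParabolicSemidirect`, which is not imported here to keep the adelic integration theory out of
the dependency cone of this `p`-adic file.) [folklore] -/
private theorem continuous_leviProjection' : Continuous (leviProjection R c) := by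
  refine continuous_pi fun a => Units.continuous_iff.2 ⟨?_, ?_⟩
  · exact continuous_matrix fun i j =>
      (Units.continuous_val.comp continuous_subtype_val).matrix_elem (i : n) (j : n)
  · exact continuous_matrix fun i j =>
      ((Units.continuous_val.comp continuous_subtype_val).comp continuous_inv).matrix_elem
        (i : n) (j : n)

/-- The Levi embedding `Π_a GL_{n_a}(R) → GL_n(R)` (block diagonal matrices) is continuous.
(A private copy of `Literature.NumberTheory.Automorphic.continuous_blockDiagonalGL` of
`ParabolicSemidirect`, see `continuous_leviProjection'`.) [folklore] -/
private theorem continuous_blockDiagonalGL' [Fintype α] : Continuous (blockDiagonalGL R c) := by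
  have hval : Continuous fun m : (Π a, GL {i // c i = a} R) =>
      ((blockDiagonalGL R c m : GL n R) : Matrix n n R) := by
    have h : Continuous fun m : (Π a, GL {i // c i = a} R) => fun a =>
        ((m a : GL {i // c i = a} R) : Matrix {i // c i = a} {i // c i = a} R) :=
      continuous_pi fun a => Units.continuous_val.comp (continuous_apply a)
    refine continuous_matrix fun i j => ?_
    simp_rw [blockDiagonalGL_apply_coe]
    exact h.matrix_blockDiagonal'.matrix_elem _ _
  refine Units.continuous_iff.2 ⟨hval, ?_⟩
  have : (fun m : (Π a, GL {i // c i = a} R) => (((blockDiagonalGL R c m)⁻¹ : GL n R) : Matrix n n R)) =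
      fun m => ((blockDiagonalGL R c m⁻¹ : GL n R) : Matrix n n R) := by
    funext m
    rw [map_inv]
  rw [this]
  exact hval.comp continuous_inv

end Levi

/-! ### The Iwasawa decomposition `GL_n(F) = P_c · K₀` for an arbitrary index type -/

section Iwasawa

variable (F : Type*) [Field F] [ValuativeRel F] [TopologicalSpace F] [IsNonarchimedeanLocalField F]
  {n : Type*} [Fintype n] [DecidableEq n] {α : Type*} [LinearOrder α] (c : n → α)

/-- **Iwasawa decomposition for a standard parabolic of `GL_n(F)`** over a non-archimedean local
field, for an arbitrary finite index type `n` and block labelling `c : n → α`: there is a compact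
open subgroup `K₀ ≤ GL_n(F)` (namely `GL_n(𝒪)` transported along an enumeration `Fin N ≃ n`
making `c` monotone) with `GL_n(F) = P_c · K₀`. From `GL_N(F) = B(F) · GL_N(𝒪)`
(`exists_borel_mul_glInt`, Bump 1997, Prop. 4.5.2) and `B ≤ P_c`. (Bernstein–Zelevinsky 1977,
§2.3: "`G` is compact modulo `P`".) [cite: Bump1997, Prop. 4.5.2] -/
theorem exists_isCompact_isOpen_forall_standardParabolicGL_mul :
    ∃ K₀ : Subgroup (GL n F), IsCompact (K₀ : Set (GL n F)) ∧ IsOpen (K₀ : Set (GL n F)) ∧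
      ∀ g : GL n F, ∃ p ∈ standardParabolicGL F c, ∃ k ∈ K₀, g = p * k := by
  classical
  -- an enumeration `e : Fin N ≃ n` along which `c` is monotone
  obtain ⟨N, e, hmono⟩ : ∃ (N : ℕ) (e : Fin N ≃ n), Monotone (c ∘ e) :=
    ⟨Fintype.card n, (Tuple.sort (c ∘ (Fintype.equivFin n).symm)).trans (Fintype.equivFin n).symm,
      Tuple.monotone_sort (c ∘ (Fintype.equivFin n).symm)⟩
  -- the reindexing isomorphism and its continuity in both directions
  let φ : GL (Fin N) F ≃* GL n F := reindexGL e
  have hφ : Continuous φ :=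
    Units.continuous_map (f := (Matrix.reindexAlgEquiv F F e).toMulEquiv.toMonoidHom)
      (continuous_id.matrix_reindex e e)
  have hφ' : Continuous φ.symm :=
    Units.continuous_map (f := (Matrix.reindexAlgEquiv F F e.symm).toMulEquiv.toMonoidHom)
      (continuous_id.matrix_reindex e.symm e.symm)
  refine ⟨(glInt N F).map φ.toMonoidHom, ?_, ?_, fun g => ?_⟩
  · rw [Subgroup.coe_map]
    exact (isCompact_glInt N F).image hφ
  · have h : ((glInt N F).map φ.toMonoidHom : Set (GL n F)) = φ.symm ⁻¹' (glInt N F : Set _) := by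
      ext g
      simp only [SetLike.mem_coe, Subgroup.mem_map_equiv, Set.mem_preimage]
    rw [h]
    exact (isOpen_glInt N F).preimage hφ'
  · obtain ⟨b, hb, k, hk, hgk⟩ := exists_borel_mul_glInt (φ.symm g)
    refine ⟨φ b, ?_, φ k, ⟨k, hk, rfl⟩, ?_⟩
    · -- `φ b` is block triangular for `c` since `b` is upper triangular and `c ∘ e` is monotone
      intro i j hij
      change Matrix.reindex e e (b : Matrix (Fin N) (Fin N) F) i j = 0
      rw [Matrix.reindex_apply, Matrix.submatrix_apply]
      refine hb ?_
      by_contra h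
      have h' := hmono (not_lt.1 h)
      simp only [Function.comp_apply, id_eq, Equiv.apply_symm_apply] at h'
      exact absurd hij (not_lt.2 h')
    · rw [← map_mul, ← hgk, MulEquiv.apply_symm_apply]

end Iwasawa

end Literature.NumberTheory.Automorphic

/-! ### The discharge -/

namespace Representation

open Literature.NumberTheory.Automorphic

/-- The zero element of `Ind_H^G σ` is the zero function (unfolding lemma, complements
`SmoothInd.toFun_add` / `SmoothInd.toFun_smul`; a deliberate dot-notation extension in the
`Representation` namespace like the rest of `SmoothInduction`). [folklore] -/
@[simp] lemma SmoothInd.toFun_zero {k G W : Type*} [CommRing k] [Group G] [TopologicalSpace G]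
    [SeparatelyContinuousMul G] [AddCommGroup W] [Module k W] (H : Subgroup G)
    (σ : Representation k H W) : (0 : SmoothInd H σ).toFun = 0 := rfl

variable (F : Type*) [Field F] [ValuativeRel F] [TopologicalSpace F] [IsNonarchimedeanLocalField F]
  {n : Type*} [Fintype n] [DecidableEq n] {α : Type*} [LinearOrder α] [Fintype α] (c : n → α)

/-- **Parabolic induction preserves admissibility on `GL_n(F)`** (discharge of
`Representation.isAdmissible_parabolicIndGL`): for an admissible representation `σ` of
`Π_a GL_{n_a}(F)`, `i_c σ = Ind_{P_c}^{GL_n(F)} (σ ∘ proj ⊗ δ^{1/2})` is admissible. Proof as in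
the module docstring: `GL_n(F) = P_c K₀` (Iwasawa), finitely many cosets `s K` cover `K₀`, and
`f ↦ (f(s))_s` embeds `(i_c σ)^K` into `⊕_s W^{proj(P_c ∩ s K s⁻¹)}`, each finite-dimensional by
admissibility of `σ` (`δ_{P_c} = 1` on the compact open subgroup `P_c ∩ s K s⁻¹`).
(Bernstein–Zelevinsky 1977, Prop. 2.3 (e) with Prop. 1.9 (e); Bernstein–Zelevinsky 1976, §2.25.) [cite: BernsteinZelevinsky1977, Prop. 2.3(e)] -/
theorem isAdmissible_parabolicIndGL_holds : isAdmissible_parabolicIndGL F c := by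
  intro _ W _ _ σ hσ
  refine ⟨isSmooth_smoothInd _ _, fun K hK => ?_⟩
  -- notation
  let P : Subgroup (GL n F) := standardParabolicGL F c
  let τ : Representation ℂ P W :=
    Representation.twist (σ.comp (leviProjection F c)) (rootDeltaChar P)
  change Module.Finite ℂ ((smoothIndRep P τ).fixedPoints (K : Subgroup (GL n F)))
  have hPc : IsClosed (P : Set (GL n F)) := isClosed_standardParabolicGL F c
  -- Iwasawa decomposition and finitely many cosets
  obtain ⟨K₀, hK₀c, -, hPK₀⟩ := exists_isCompact_isOpen_forall_standardParabolicGL_mul F c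
  obtain ⟨t, ht⟩ := exists_finset_forall_inv_mul_mem hK₀c K.isOpen
  have hdec : ∀ g : GL n F, ∃ (p : P) (s : GL n F) (_ : s ∈ t) (k : GL n F)
      (_ : k ∈ (K : Subgroup (GL n F))), g = p * s * k := by
    intro g
    obtain ⟨p, hp, k₀, hk₀, rfl⟩ := hPK₀ g
    obtain ⟨s, hs, hsk⟩ := ht k₀ hk₀
    exact ⟨⟨p, hp⟩, s, hs, s⁻¹ * k₀, hsk, by rw [mul_assoc, mul_inv_cancel_left]⟩
  -- `K`-fixed vectors are right `K`-invariant functions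
  have hfix : ∀ f ∈ (smoothIndRep P τ).fixedPoints (K : Subgroup (GL n F)),
      ∀ k ∈ (K : Subgroup (GL n F)), ∀ x : GL n F, SmoothInd.toFun f (x * k) = f.toFun x := by
    intro f hf k hk x
    rw [mem_fixedPoints] at hf
    have h := congrArg (fun f' : SmoothInd P τ => f'.toFun x) (hf k hk)
    simpa only [toFun_smoothIndRep_apply] using h
  -- the compact open subgroups `proj (P ∩ s K s⁻¹)` of the Levi
  let H : GL n F → Subgroup P := fun s =>
    (K : Subgroup (GL n F)).comap ((MulAut.conj s).symm.toMonoidHom.comp P.subtype)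
  let KM : GL n F → Subgroup (Π a, GL {i // c i = a} F) := fun s => (H s).map (leviProjection F c)
  have hKMc : ∀ s, IsCompact (KM s : Set (Π a, GL {i // c i = a} F)) := fun s =>
    (isCompact_comap_conj_symm_subtype hPc hK s).image (continuous_leviProjection' c)
  have hKMo : ∀ s, IsOpen (KM s : Set (Π a, GL {i // c i = a} F)) := fun s => by
    refine Subgroup.isOpen_mono (H₁ := (K : Subgroup (GL n F)).comap
      ((MulAut.conj s).symm.toMonoidHom.comp (blockDiagonalGL F c))) ?_ ?_
    · intro m hm
      refine ⟨leviEmbeddingP F c m, ?_, leviProjection_leviEmbeddingP_apply c m⟩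
      rw [SetLike.mem_coe, mem_comap_conj_symm_subtype]
      simpa [MulAut.conj_symm_apply] using hm
    · have hset : ((K : Subgroup (GL n F)).comap
          ((MulAut.conj s).symm.toMonoidHom.comp (blockDiagonalGL F c)) :
            Set (Π a, GL {i // c i = a} F)) =
          (fun m => s⁻¹ * blockDiagonalGL F c m * s) ⁻¹' (K : Set (GL n F)) := by
        ext m
        simp [MulAut.conj_symm_apply]
      rw [hset]
      exact K.isOpen.preimage
        ((continuous_const.mul (continuous_blockDiagonalGL' c)).mul continuous_const)
  -- `f(s)` is fixed by `σ (proj (P ∩ s K s⁻¹))`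
  have hmem : ∀ f ∈ (smoothIndRep P τ).fixedPoints (K : Subgroup (GL n F)), ∀ s : GL n F,
      SmoothInd.toFun f s ∈ σ.fixedPoints (KM s) := by
    intro f hf s
    rw [mem_fixedPoints]
    rintro _ ⟨p, hp, rfl⟩
    have h1 : f.toFun ((p : GL n F) * s) = τ p (f.toFun s) := SmoothInd.toFun_subgroup_mul f p s
    have h2 : f.toFun ((p : GL n F) * s) = f.toFun s := by
      have h := hfix f hf (s⁻¹ * (p : GL n F) * s) (mem_comap_conj_symm_subtype.1 hp) s
      rwa [← mul_assoc, mul_inv_cancel_left] at h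
    have hmod : Measure.modularCharacter p = 1 :=
      modularCharacter_eq_one_of_mem_comap_conj hPc K.isOpen hK hp
    have hδ : rootDeltaChar P p = 1 := by
      ext
      rw [rootDeltaChar_apply, hmod, NNReal.sqrt_one, Units.val_one, NNReal.coe_one,
        Complex.ofReal_one]
    rw [h2, twist_apply, hδ, Units.val_one, one_smul] at h1
    exact h1.symm
  -- the evaluation map `f ↦ (f(s))_{s ∈ t}` and its injectivity
  let Φ : (smoothIndRep P τ).fixedPoints (K : Subgroup (GL n F)) →ₗ[ℂ]
      (Π s : t, σ.fixedPoints (KM s)) :=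
    { toFun := fun f s => ⟨SmoothInd.toFun f.1 s, hmem f.1 f.2 s⟩
      map_add' := fun f g => by
        funext s
        rfl
      map_smul' := fun r f => by
        funext s
        rfl }
  have hΦ : Function.Injective Φ := by
    rw [← LinearMap.ker_eq_bot, LinearMap.ker_eq_bot']
    intro f hf
    apply Subtype.ext
    apply SmoothInd.ext
    funext g
    obtain ⟨p, s, hs, k, hk, rfl⟩ := hdec g
    have h0 : SmoothInd.toFun f.1 s = 0 :=
      congrArg (fun v : (Π s : t, σ.fixedPoints (KM s)) => ((v ⟨s, hs⟩ : σ.fixedPoints (KM s)) : W)) hf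
    change SmoothInd.toFun f.1 _ = SmoothInd.toFun (0 : SmoothInd P τ) _
    rw [SmoothInd.toFun_zero, Pi.zero_apply, hfix f.1 f.2 k hk, SmoothInd.toFun_subgroup_mul, h0,
      map_zero]
  -- finite-dimensionality
  haveI : ∀ s : t, Module.Finite ℂ (σ.fixedPoints (KM s)) := fun s =>
    hσ.2 ⟨KM s, hKMo s⟩ (hKMc s)
  exact Module.Finite.of_injective Φ hΦ

end Representation
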